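import Summits.HodgeConjecture.HodgeConjecture.Theorems.H413CharacterKnobSolve
import Summits.HodgeConjecture.HodgeConjecture.Theorems.H413ThetaDistAtLineArchTypes
import HarnessLib
/-!
# FLOOR-0 P4, S4b — two kernel helpers of the S4b closer: the slot-`0` character of the knob `(1, χ₀(·,1)·κ⁻¹)` IS `κ`; transport of the slot sign

Cell hodgecm-mathlib (D-0151), FLOOR 0, crux item H413 = stmt-HodgeConjecture-24833; P4 line (ED. 3) `Cruxes/H413/Lines/F0_P4AdmissibleOccursInH1.lean`,
stub S4b `stub_T3a_holThetaAtAdmissibleLineOfRallisAt`.  Author F0P4-p01 (g2) (seat (i), S4b closer).  `--supports stmt-HodgeConjecture-24833 --as helper`.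
DEF-FREE; nothing is cited as a fact, no `sorry`.

* `lineCharV_zero_etaT₀_one_knobNu` — for the knob `(η, ν) := (1, χ₀(·,1) · κ⁻¹)` of ★ `H413CharacterKnobSolve.exists_knob` (F0P4-p01 (g0)) the slot-`0`
  character `lineCharV_zero … (etaT₀ 1 ν)` of the side at the line IS `κ` (the see-saw character `χ₀` cancels) — the `Ξ` of ★ `H413ThetaDistAtLineArchTypes`
  (F0P4-p04 (g2)), adelic companion of ★ `finCharZero_etaT₀_one_knobNu_inl`.
* `cmXW_pos_iff_of_eq` — the slot sign `hpos` of ★ `H413ThetaDistAtLineArchRows` depends only on the line scalar: transport along `d = d'` (the admissible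
  line of ★ `AdmissibleLine.exists_admissibleLine` is given by the EQUATION `a = e·2δ`).
Consumed by ★ `Theorems/H413HolThetaAtAdmissibleLine` (the S4b closer modulo the `(χ)`+`(N)` row).  HC_CM is proved only modulo the printed citations
until rung 0 closes; this file proves nothing about them.

## References
* [GelbartRogawski1991] S. Gelbart, J. Rogawski, Invent. Math. 105 (1991), §3.1 Remark p. 457 L4–13 (the see-saw character).
* Tree (all ★): `Theorems/H413CharacterKnobSolve` (`mul_inv_inv_mul_cancel_aux`), `HodgeCM/Model/ArchKTypeOfCentralWeight_1` (`lineCharV_zero_apply`),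
  `HodgeCM/Model/ArchSideOfTwist` (`etaT₀_apply_mk_one`), `HodgeCM/Model/HypCensus/ArchDatumBlockCM` (`cmXW`, `cmPlace`).
-/

set_option autoImplicit false
set_option linter.dupNamespace false

noncomputable section

open MulAction NumberField NumberField.InfinitePlace NumberField.mixedEmbedding IsDedekindDomain
open scoped Matrix TensorProduct Classical SchwartzMap
open Literature.NumberTheory.Automorphic Literature.NumberTheory.Weil1964
open Literature.NumberTheory.GelbartRogawski1991 Literature.NumberTheory.GelbartRogawski1991.UnitaryDualPair
open Literature.AlgebraicGeometry.ShimuraVarieties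
open HodgeCM HodgeCM.Adelic HodgeCM.PerL34 HodgeCM.Model HodgeCM.Model.ArchSideTerm HodgeCM.Model.ThetaDistFin HodgeCM.Model.ThetaAdelicSide
open HodgeCM.Model.HypCensus

namespace Summit.HodgeConjecture.HodgeConjecture.Cruxes.H413.ThetaJunction

/-! ## §1 The slot-`0` character of the knob `(1, χ₀(·,1)·κ⁻¹)` is `κ` -/

section SlotZero

variable {L : CMField} {ι₁ : L →+* ℂ} (V : HermSpace3 L ι₁) (c : SeesawCtx L)
  (hGR : (cmSplittingDatum (L : Type) finProdFinEquiv (frameD V) (frameD_real V) (frameD_ne V) (dW c.D) (dW_real c.D)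
    (dW_ne c.D)).CompatibleSplitting)
  (hGR₀ : (cmSplittingDatum (L : Type) (e₁) (frameD V) (frameD_real V) (frameD_ne V) (lineVec (L : Type) (dW c.D 0))
    (fun _ => dW_real c.D 0) (fun _ => dW_ne c.D 0)).CompatibleSplitting)
  (hGR₁ : (cmSplittingDatum (L : Type) (e₁) (frameD V) (frameD_real V) (frameD_ne V) (lineVec (L : Type) (dW c.D 1))
    (fun _ => dW_real c.D 1) (fun _ => dW_ne c.D 1)).CompatibleSplitting)
  (κ : CMAdelic (L : Type) (frameD V) →* ℂˣ)

/-- **the slot-`0` character of the knob `(η, ν) := (1, χ₀(·,1) · κ⁻¹)` IS `κ`**: `lineCharV_zero … (etaT₀ 1 ν) = κ` (the see-saw character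
`χ₀` cancels; adelic companion of ★ `finCharZero_etaT₀_one_knobNu_inl`). [cite: GelbartRogawski1991, §3.1 Remark p. 457 L4–13] -/
theorem lineCharV_zero_etaT₀_one_knobNu :
    lineCharV_zero V c.D hGR hGR₀ hGR₁
        (etaT₀ V c.D (1 : CMAdelic (L : Type) (frameD V) × CMAdelic (L : Type) (dW c.D) →* ℂˣ)
          ((cmLineChar₀ (L : Type) finProdFinEquiv e₁ (frameD V) (frameD_real V) (frameD_ne V) (dW c.D) (dW_real c.D) (dW_ne c.D) hGR
              hGR₀ hGR₁).comp (MonoidHom.inl _ _) * κ⁻¹)) = κ := by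
  ext v
  rw [lineCharV_zero_apply, etaT₀_apply_mk_one, MonoidHom.one_apply, mul_one, MonoidHom.mul_apply, MonoidHom.comp_apply,
    MonoidHom.inv_apply]
  change ((((cmLineChar₀ (L : Type) finProdFinEquiv e₁ (frameD V) (frameD_real V) (frameD_ne V) (dW c.D) (dW_real c.D) (dW_ne c.D) hGR
      hGR₀ hGR₁) (v, 1) * (κ v)⁻¹)⁻¹ *
    (cmLineChar₀ (L : Type) finProdFinEquiv e₁ (frameD V) (frameD_real V) (frameD_ne V) (dW c.D) (dW_real c.D) (dW_ne c.D) hGR hGR₀ hGR₁) (v, 1) :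
      ℂˣ) : ℂ) = _
  rw [mul_inv_inv_mul_cancel_aux]

end SlotZero

/-! ## §2 Transport of the slot sign along an equality of line scalars -/

section Sign

variable {L : CMField} {ι₁ : L →+* ℂ} (V : HermSpace3 L ι₁)

/-- the slot-`0` sign `0 < x_W(v₁)` of the line `⟨d⟩` depends only on the scalar `d` (transport along `d = d'`; the real-ness proofs are irrelevant). [folklore] -/
theorem cmXW_pos_iff_of_eq {d d' : (L : Type)} (h : d = d') (hd : ∀ _ : Fin 1, IsCMField.complexConj (L : Type) d = d)
    (hd' : ∀ _ : Fin 1, IsCMField.complexConj (L : Type) d' = d') :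
    0 < cmXW (L : Type) (frameD V) (lineVec (L : Type) d) hd ι₁ (cmPlace (L : Type) ι₁) 0 ↔
      0 < cmXW (L : Type) (frameD V) (lineVec (L : Type) d') hd' ι₁ (cmPlace (L : Type) ι₁) 0 := by
  subst h
  exact Iff.rfl

end Sign


end Summit.HodgeConjecture.HodgeConjecture.Cruxes.H413.ThetaJunction

end
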